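import Mathlib
import Summits.KontsevichZagierPeriods.Zeta5Search.FourthOrderResidueA
import Summits.KontsevichZagierPeriods.Zeta5Search.PolynomialResiduesHigher
import HarnessLib

/-!
# ζ(5) search — the residue identity with poles of order ≤ 4 (abstract form over `ZMod p`)

HONEST FRAMING: systematic search; no irrationality claim unless certified.

Cell `pub-zeta5`, gen-2 seat generation 15 (REPORT-gen2-g15 §6): the ABSTRACT fourth-order residue identity behind the residue side
of the second residue law L5 (`SecondOrder.liveKappaSum_small`, next file).  PURE ALGEBRA over `ZMod p` (no statement about ζ(5)).
For an exponent vector `E : ℕ → ℤ` on the residues mod `p` (`p ≥ 5` prime), an EVEN shift `M ≥ 4` with `E ≥ −M` and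
`p(M − 4) + Σ_{y<p} E_y ≤ −2`, put `e_y := E_y + M − 4 ∈ [−4, ∞)`; the rational function `∏_{y<p} (X + y)^{e_y}` has poles exactly at
`X = −x`, `e_x < 0`, of order `−e_x ≤ 4`, and vanishes to order ≥ 2 at `∞`; the sum of its residues is
`Σ_{e_x<0} ḡ_x(E) · κ̄_x = 0` (`sum_gBarE_mul_kapBar_eq_zero`) with `ḡ_x(E) = ∏_{y≠x}(y−x)^{E_y⁺}/∏(y−x)^{E_y⁻}` (`ResidueLaw.gBarE`) and the
LAYER WEIGHT `κ̄_x ∈ {1, φ̄₁, (φ̄₁² − φ̄₂)/2, φ̄₁³/6 − φ̄₁φ̄₂/2 + φ̄₃/3}` according as `E_x + M = 3, 2, 1, 0`, where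
`φ̄_m = Σ_{y≠x} E_y (y − x)^{−m}` (`phiBarPow`).  The proof is the residue theorem `PolynomialResidues.sum_resGen_eq_zero` (G15-1) plus
the computation of the Taylor coefficients `c₀..c₃` of the local factor through its LOGARITHMIC coefficients (`ResidueFour.lam1/2/3`,
file `FourthOrderResidueA`): `λ_m(∏(y−x+X)^{e_y}) = (−1)^{m−1} φ̄_m/m` because `Σ_{y≠x}(y−x)^{−m} = 0` in `F_p` (`m ≤ 3 < p − 1`), and
`c₀ = (−1)^{M−4} ḡ_x = ḡ_x` (Wilson, `M` even).  The case `M − 2`, orders ≤ 2, is the tree's `ResidueLaw.residueIdentity_holds`.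
-/

open Finset Polynomial

namespace Summit.KontsevichZagierPeriods.Zeta5Search.ResidueFour

open PolynomialResidues ResidueLaw

/-! ## Taylor shifts and power-series images of products of linear factors -/

section Generic

variable {K : Type*} [Field K]

/-- `taylor r (∏ (X − a_y)^{n_y}) = ∏ (X + (r − a_y))^{n_y}`. -/
theorem taylor_prod_X_sub_C_pow (t : Finset ℕ) (a : ℕ → K) (n : ℕ → ℕ) (r : K) :
    taylor r (∏ y ∈ t, (X - C (a y)) ^ n y) = ∏ y ∈ t, (X + C (r - a y)) ^ n y := by
  classical
  induction t using Finset.induction_on with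
  | empty => rw [prod_empty, prod_empty, taylor_one, C_1]
  | insert j t hj ih =>
    rw [prod_insert hj, prod_insert hj, taylor_mul, ih, taylor_pow, map_sub, taylor_X, taylor_C, C_sub]
    congr 2
    ring

/-- The power-series image of `∏ (X + d_y)^{n_y}` is `∏ (d_y + X)^{n_y}`. -/
theorem coe_prod_X_add_C_pow (t : Finset ℕ) (d : ℕ → K) (n : ℕ → ℕ) :
    ((∏ y ∈ t, (X + C (d y)) ^ n y : K[X]) : PowerSeries K) = ∏ y ∈ t, (PowerSeries.C (d y) + PowerSeries.X) ^ n y := by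
  classical
  induction t using Finset.induction_on with
  | empty => rw [prod_empty, prod_empty, Polynomial.coe_one]
  | insert j t hj ih =>
    rw [prod_insert hj, prod_insert hj, Polynomial.coe_mul, ih, Polynomial.coe_pow, Polynomial.coe_add, Polynomial.coe_X,
      Polynomial.coe_C, add_comm PowerSeries.X]

/-- The constant coefficient of `∏ (d_y + X)^{n_y}` is `∏ d_y^{n_y}`. -/
theorem coeff_zero_prod_C_add_X_pow (t : Finset ℕ) (d : ℕ → K) (n : ℕ → ℕ) :
    PowerSeries.coeff 0 (∏ y ∈ t, (PowerSeries.C (d y) + PowerSeries.X) ^ n y) = ∏ y ∈ t, d y ^ n y := by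
  rw [coeff_zero_prod_eq]
  exact prod_congr rfl fun y _ => by rw [coeff_zero_pow_eq, coeff_zero_C_add_X]

/-- A sum of integer weights, split by sign: `Σ e_y·g_y = Σ_{e≥0} k_y·g_y − Σ_{e<0} m_y·g_y`. -/
theorem sum_intCast_mul_eq_sub (U : Finset ℕ) (e : ℕ → ℤ) (k m : ℕ → ℕ) (g : ℕ → K)
    (hk : ∀ y ∈ U, 0 ≤ e y → (k y : ℤ) = e y) (hm : ∀ y ∈ U, e y < 0 → (m y : ℤ) = -e y) :
    ∑ y ∈ U, ((e y : ℤ) : K) * g y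
      = (∑ y ∈ U.filter (fun y => 0 ≤ e y), (k y : K) * g y) - ∑ y ∈ U.filter (fun y => e y < 0), (m y : K) * g y := by
  rw [← Finset.sum_filter_add_sum_filter_not U (fun y => 0 ≤ e y), sub_eq_add_neg, ← Finset.sum_neg_distrib]
  congr 1
  · refine Finset.sum_congr rfl fun y hy => ?_
    obtain ⟨hyU, hy0⟩ := Finset.mem_filter.1 hy
    rw [← hk y hyU hy0, Int.cast_natCast]
  · refine Finset.sum_congr (Finset.filter_congr fun y _ => not_le) fun y hy => ?_
    obtain ⟨hyU, hy0⟩ := Finset.mem_filter.1 hy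
    rw [show e y = -(m y : ℤ) by rw [hm y hyU hy0]; ring, Int.cast_neg, Int.cast_natCast, neg_mul]

/-- The logarithmic coefficients of `(∏_{t₁} L_y^{k_y}) · (∏_{t₂} L_y^{m_y})⁻¹` are `Σ_{t₁} k_y λ(L_y) − Σ_{t₂} m_y λ(L_y)` — a common
statement for `λ₁, λ₂, λ₃` (any `λ` additive on products with nonzero constant terms, homogeneous on powers and odd on inverses). -/
theorem lam_prod_pow_mul_inv (lam : PowerSeries K → K)
    (hmul : ∀ {F G : PowerSeries K}, PowerSeries.coeff 0 F ≠ 0 → PowerSeries.coeff 0 G ≠ 0 → lam (F * G) = lam F + lam G)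
    (hprod : ∀ (s : Finset ℕ) (F : ℕ → PowerSeries K), (∀ i ∈ s, PowerSeries.coeff 0 (F i) ≠ 0) →
      lam (∏ i ∈ s, F i) = ∑ i ∈ s, lam (F i))
    (hpow : ∀ (F : PowerSeries K), PowerSeries.coeff 0 F ≠ 0 → ∀ n : ℕ, lam (F ^ n) = n * lam F)
    (hinv : ∀ (F : PowerSeries K), PowerSeries.coeff 0 F ≠ 0 → lam F⁻¹ = -lam F)
    (t₁ t₂ : Finset ℕ) (L : ℕ → PowerSeries K) (k m : ℕ → ℕ) (h₁ : ∀ y ∈ t₁, PowerSeries.coeff 0 (L y) ≠ 0)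
    (h₂ : ∀ y ∈ t₂, PowerSeries.coeff 0 (L y) ≠ 0) :
    lam ((∏ y ∈ t₁, L y ^ k y) * (∏ y ∈ t₂, L y ^ m y)⁻¹)
      = (∑ y ∈ t₁, (k y : K) * lam (L y)) - ∑ y ∈ t₂, (m y : K) * lam (L y) := by
  have hp₁ : ∀ y ∈ t₁, PowerSeries.coeff 0 (L y ^ k y) ≠ 0 := fun y hy => by
    rw [coeff_zero_pow_eq]; exact pow_ne_zero _ (h₁ y hy)
  have hp₂ : ∀ y ∈ t₂, PowerSeries.coeff 0 (L y ^ m y) ≠ 0 := fun y hy => by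
    rw [coeff_zero_pow_eq]; exact pow_ne_zero _ (h₂ y hy)
  have hP₁ : PowerSeries.coeff 0 (∏ y ∈ t₁, L y ^ k y) ≠ 0 := by
    rw [coeff_zero_prod_eq]; exact prod_ne_zero_iff.2 hp₁
  have hP₂ : PowerSeries.coeff 0 (∏ y ∈ t₂, L y ^ m y) ≠ 0 := by
    rw [coeff_zero_prod_eq]; exact prod_ne_zero_iff.2 hp₂
  have hP₂' : PowerSeries.coeff 0 (∏ y ∈ t₂, L y ^ m y)⁻¹ ≠ 0 := by
    rw [coeff_zero_inv_eq]; exact inv_ne_zero hP₂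
  rw [hmul hP₁ hP₂', hinv _ hP₂, hprod _ _ hp₁, hprod _ _ hp₂, ← sub_eq_add_neg]
  congr 1
  · exact sum_congr rfl fun y hy => hpow _ (h₁ y hy) _
  · exact sum_congr rfl fun y hy => hpow _ (h₂ y hy) _

end Generic

/-! ## The data of the identity -/

section Data

/-- `φ̄_{m,x}(E) := Σ_{y<p, y≠x} E_y · ((y − x)⁻¹)^m` in `ZMod p` (`m = 1`: `ResidueLaw.phiBarE`). -/
def phiBarPow (p : ℕ) (E : ℕ → ℤ) (x m : ℕ) : ZMod p :=
  ∑ y ∈ (range p).erase x, ((E y : ℤ) : ZMod p) * (((y : ZMod p) - (x : ZMod p))⁻¹) ^ m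

/-- The LAYER WEIGHT `κ̄_x`: `φ̄₁³/6 − φ̄₁φ̄₂/2 + φ̄₃/3`, `(φ̄₁² − φ̄₂)/2`, `φ̄₁`, `1` on the layers `E_x + M = 0, 1, 2, ≥ 3`. -/
def kapBar (p : ℕ) [Fact p.Prime] (E : ℕ → ℤ) (M x : ℕ) : ZMod p :=
  if E x + (M : ℤ) = 0 then
    phiBarPow p E x 1 ^ 3 / 6 - phiBarPow p E x 1 * phiBarPow p E x 2 / 2 + phiBarPow p E x 3 / 3
  else if E x + (M : ℤ) = 1 then (phiBarPow p E x 1 ^ 2 - phiBarPow p E x 2) / 2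
  else if E x + (M : ℤ) = 2 then phiBarPow p E x 1 else 1

/-- The pole set `{x < p : E_x + M − 4 < 0}`. -/
def poleSet (p : ℕ) (E : ℕ → ℤ) (M : ℕ) : Finset ℕ := (range p).filter (fun x => E x + (M : ℤ) - 4 < 0)

/-- The regular set `{x < p : 0 ≤ E_x + M − 4}`. -/
def regSet (p : ℕ) (E : ℕ → ℤ) (M : ℕ) : Finset ℕ := (range p).filter (fun x => 0 ≤ E x + (M : ℤ) - 4)

/-- The pole orders `−(E_x + M − 4)`. -/
def mult (E : ℕ → ℤ) (M : ℕ) (x : ℕ) : ℕ := (-(E x + (M : ℤ) - 4)).toNat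

/-- The regular exponents `E_x + M − 4`. -/
def kreg (E : ℕ → ℤ) (M : ℕ) (x : ℕ) : ℕ := (E x + (M : ℤ) - 4).toNat

/-- The numerator `∏_{e_y ≥ 0} (X + y)^{e_y}`. -/
noncomputable def numPoly (p : ℕ) (E : ℕ → ℤ) (M : ℕ) : (ZMod p)[X] :=
  ∏ y ∈ regSet p E M, (X - C (-((y : ℕ) : ZMod p))) ^ kreg E M y

/-- `mem_poleSet` (auxiliary lemma). -/
theorem mem_poleSet {p : ℕ} {E : ℕ → ℤ} {M x : ℕ} : x ∈ poleSet p E M ↔ x < p ∧ E x + (M : ℤ) - 4 < 0 := by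
  simp only [poleSet, mem_filter, mem_range]

/-- `mem_regSet` (auxiliary lemma). -/
theorem mem_regSet {p : ℕ} {E : ℕ → ℤ} {M x : ℕ} : x ∈ regSet p E M ↔ x < p ∧ 0 ≤ E x + (M : ℤ) - 4 := by
  simp only [regSet, mem_filter, mem_range]

end Data

/-! ## The local expansion at a pole and its first four coefficients -/

section Local

variable {p : ℕ} [hp : Fact p.Prime]

/-- `natCast_injOn` (auxiliary lemma). -/
theorem natCast_injOn {x y : ℕ} (hx : x < p) (hy : y < p) (hxy : (x : ZMod p) = (y : ZMod p)) : x = y := by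
  have h' := congrArg ZMod.val hxy
  rwa [ZMod.val_cast_of_lt hx, ZMod.val_cast_of_lt hy] at h'

/-- `2, 3, 6 ≠ 0` in `ZMod p` for `p ≥ 5`. -/
theorem two_three_six_ne_zero (hp5 : 5 ≤ p) : (2 : ZMod p) ≠ 0 ∧ (3 : ZMod p) ≠ 0 ∧ (6 : ZMod p) ≠ 0 := by
  have h2 : (2 : ZMod p) ≠ 0 := by
    intro h
    have h' : ((2 : ℕ) : ZMod p) = 0 := by exact_mod_cast h
    rw [ZMod.natCast_eq_zero_iff] at h'
    have := Nat.le_of_dvd two_pos h'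
    omega
  have h3 : (3 : ZMod p) ≠ 0 := by
    intro h
    have h' : ((3 : ℕ) : ZMod p) = 0 := by exact_mod_cast h
    rw [ZMod.natCast_eq_zero_iff] at h'
    have := Nat.le_of_dvd (by norm_num) h'
    omega
  exact ⟨h2, h3, by rw [show (6 : ZMod p) = 2 * 3 by norm_num]; exact mul_ne_zero h2 h3⟩

/-- The local expansion of `numPoly / cofactor_x` at the pole `−x`, as a product of linear factors `(y − x) + X`. -/
theorem localExpansion_numPoly_eq (E : ℕ → ℤ) (M : ℕ) (x : ℕ) :
    localExpansion (-((x : ℕ) : ZMod p)) (numPoly p E M)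
        (cofactor (poleSet p E M) (fun y : ℕ => -((y : ℕ) : ZMod p)) (mult E M) x)
      = (∏ y ∈ regSet p E M, (PowerSeries.C ((y : ZMod p) - (x : ZMod p)) + PowerSeries.X) ^ kreg E M y)
        * (∏ y ∈ (poleSet p E M).erase x, (PowerSeries.C ((y : ZMod p) - (x : ZMod p)) + PowerSeries.X) ^ mult E M y)⁻¹ := by
  unfold localExpansion numPoly cofactor
  rw [taylor_prod_X_sub_C_pow, taylor_prod_X_sub_C_pow, coe_prod_X_add_C_pow, coe_prod_X_add_C_pow]
  simp only [neg_sub_neg]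

/-- **The first four Taylor coefficients at a pole.**  For `x` in the pole set, the generalised residue
`Res_{−x} = c_{m_x − 1}(numPoly/cofactor_x)` equals `ḡ_x(E) · κ̄_x`. -/
theorem resGen_numPoly_eq (E : ℕ → ℤ) (M : ℕ) (hp5 : 5 ≤ p) (hM : 4 ≤ M) (hMe : Even M)
    (hE : ∀ y, y < p → -(M : ℤ) ≤ E y) {x : ℕ} (hx : x ∈ poleSet p E M) :
    resGen (poleSet p E M) (fun y : ℕ => -((y : ℕ) : ZMod p)) (mult E M) (numPoly p E M) x = gBarE p E x * kapBar p E M x := by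
  classical
  obtain ⟨hxp, hex⟩ := mem_poleSet.1 hx
  have hEx := hE x hxp
  obtain ⟨h2, h3, -⟩ := two_three_six_ne_zero hp5
  -- notation
  set U : Finset ℕ := (range p).erase x with hU
  set T := regSet p E M with hT
  set S := poleSet p E M with hS
  set d : ℕ → ZMod p := fun y => (y : ZMod p) - (x : ZMod p) with hd
  set L : ℕ → PowerSeries (ZMod p) := fun y => PowerSeries.C (d y) + PowerSeries.X with hL
  have hdU : ∀ y ∈ U, d y ≠ 0 := by
    intro y hy
    obtain ⟨hyx, hyp⟩ := mem_erase.1 hy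
    exact sub_ne_zero.2 fun h => hyx (natCast_injOn (mem_range.1 hyp) hxp h)
  -- `U` splits into `T` and `S ∖ {x}`
  have hUT : U.filter (fun y => 0 ≤ E y + (M : ℤ) - 4) = T := by
    ext y
    simp only [hU, hT, mem_filter, mem_erase, mem_range, mem_regSet]
    constructor
    · rintro ⟨⟨-, hyp⟩, hy⟩; exact ⟨hyp, hy⟩
    · rintro ⟨hyp, hy⟩; exact ⟨⟨by rintro rfl; omega, hyp⟩, hy⟩
  have hUS : U.filter (fun y => E y + (M : ℤ) - 4 < 0) = S.erase x := by
    ext y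
    simp only [hU, hS, mem_filter, mem_erase, mem_range, mem_poleSet]
    constructor
    · rintro ⟨⟨hyx, hyp⟩, hy⟩; exact ⟨hyx, hyp, hy⟩
    · rintro ⟨hyx, hyp, hy⟩; exact ⟨⟨hyx, hyp⟩, hy⟩
  have hTU : T ⊆ U := by rw [← hUT]; exact filter_subset _ _
  have hSU : S.erase x ⊆ U := by rw [← hUS]; exact filter_subset _ _
  have hLT : ∀ y ∈ T, PowerSeries.coeff 0 (L y) ≠ 0 := fun y hy => by
    simp only [hL, coeff_zero_C_add_X]; exact hdU y (hTU hy)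
  have hLS : ∀ y ∈ S.erase x, PowerSeries.coeff 0 (L y) ≠ 0 := fun y hy => by
    simp only [hL, coeff_zero_C_add_X]; exact hdU y (hSU hy)
  have hk : ∀ y ∈ U, 0 ≤ E y + (M : ℤ) - 4 → (kreg E M y : ℤ) = E y + (M : ℤ) - 4 :=
    fun y _ hy => Int.toNat_of_nonneg hy
  have hm : ∀ y ∈ U, E y + (M : ℤ) - 4 < 0 → (mult E M y : ℤ) = -(E y + (M : ℤ) - 4) :=
    fun y _ hy => Int.toNat_of_nonneg (by omega)
  -- the local factor
  set F : PowerSeries (ZMod p) := (∏ y ∈ T, L y ^ kreg E M y) * (∏ y ∈ S.erase x, L y ^ mult E M y)⁻¹ with hF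
  have hloc : localExpansion (-((x : ℕ) : ZMod p)) (numPoly p E M)
      (cofactor S (fun y : ℕ => -((y : ℕ) : ZMod p)) (mult E M) x) = F := localExpansion_numPoly_eq E M x
  -- `c₀ = ḡ_x`
  have hc0 : PowerSeries.coeff 0 F = gBarE p E x := by
    rw [hF, coeff_zero_mul_eq, coeff_zero_inv_eq, coeff_zero_prod_C_add_X_pow, coeff_zero_prod_C_add_X_pow, ← div_eq_mul_inv,
      ← hUT, ← hUS, ← prod_zpow_eq_div U (fun y => E y + (M : ℤ) - 4) (kreg E M) (mult E M) d hk hm]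
    have hsh := prod_zpow_shift_eq E (M - 2) (by omega) hxp
    have hexp : ∀ y ∈ U, d y ^ (E y + (M : ℤ) - 4) = ((y : ZMod p) - (x : ZMod p)) ^ (E y + ((M - 2 : ℕ) : ℤ) - 2) :=
      fun y _ => by rw [hd, show E y + ((M - 2 : ℕ) : ℤ) - 2 = E y + (M : ℤ) - 4 by omega]
    rw [prod_congr rfl hexp, hsh, Even.neg_one_pow (by obtain ⟨k, hk⟩ := hMe; exact ⟨k - 2, by omega⟩), one_mul]
  have hc0' : PowerSeries.coeff 0 F ≠ 0 := by
    rw [hF, coeff_zero_mul_eq, coeff_zero_inv_eq]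
    refine mul_ne_zero ?_ (inv_ne_zero ?_)
    · rw [coeff_zero_prod_eq]
      exact prod_ne_zero_iff.2 fun y hy => by rw [coeff_zero_pow_eq]; exact pow_ne_zero _ (hLT y hy)
    · rw [coeff_zero_prod_eq]
      exact prod_ne_zero_iff.2 fun y hy => by rw [coeff_zero_pow_eq]; exact pow_ne_zero _ (hLS y hy)
  -- the weighted sums `Σ_U e_y g(y)` with `Σ_U g = 0`
  have hwsum : ∀ (g : ℕ → ZMod p), ∑ y ∈ U, g y = 0 →
      (∑ y ∈ T, (kreg E M y : ZMod p) * g y) - ∑ y ∈ S.erase x, (mult E M y : ZMod p) * g y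
        = ∑ y ∈ U, ((E y : ℤ) : ZMod p) * g y := by
    intro g hg
    rw [← hUT, ← hUS, ← sum_intCast_mul_eq_sub U (fun y => E y + (M : ℤ) - 4) (kreg E M) (mult E M) g hk hm]
    have : ∀ y ∈ U, (((E y + (M : ℤ) - 4 : ℤ)) : ZMod p) * g y = ((E y : ℤ) : ZMod p) * g y + (((M : ℤ) - 4 : ℤ) : ZMod p) * g y :=
      fun y _ => by push_cast; ring
    rw [sum_congr rfl this, sum_add_distrib, ← mul_sum, hg, mul_zero, add_zero]
  have hps : ∀ m : ℕ, 1 ≤ m → m ≤ 3 → ∑ y ∈ U, (d y)⁻¹ ^ m = 0 := fun m hm1 hm3 =>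
    sum_range_erase_inv_sub_pow_eq_zero hxp hm1 (by omega)
  -- `λ₁ = φ̄₁`, `λ₂ = −φ̄₂/2`, `λ₃ = φ̄₃/3`
  have hl1 : lam1 F = phiBarPow p E x 1 := by
    rw [hF, lam_prod_pow_mul_inv lam1 lam1_mul lam1_prod lam1_pow lam1_inv T (S.erase x) L _ _ hLT hLS]
    simp only [hL, lam1_C_add_X]
    rw [hwsum (fun y => (d y)⁻¹) (by simpa using hps 1 le_rfl (by norm_num)), phiBarPow]
    simp only [hd, hU, pow_one]
  have hl2 : lam2 F = -(phiBarPow p E x 2) / 2 := by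
    rw [hF, lam_prod_pow_mul_inv lam2 (fun hF hG => lam2_mul hF hG h2) (fun s F h0 => lam2_prod s F h0 h2)
      (fun F hF => lam2_pow F hF h2) (fun F hF => lam2_inv F hF h2) T (S.erase x) L _ _ hLT hLS]
    simp only [hL, lam2_C_add_X]
    rw [hwsum (fun y => -((d y)⁻¹) ^ 2 / 2) (by rw [← sum_div, sum_neg_distrib, hps 2 (by norm_num) (by norm_num), neg_zero, zero_div]),
      phiBarPow, ← sum_neg_distrib, sum_div]
    simp only [hd, hU]
    exact sum_congr rfl fun y _ => by ring
  have hl3 : lam3 F = phiBarPow p E x 3 / 3 := by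
    rw [hF, lam_prod_pow_mul_inv lam3 (fun hF hG => lam3_mul hF hG h3) (fun s F h0 => lam3_prod s F h0 h3)
      (fun F hF => lam3_pow F hF h3) (fun F hF => lam3_inv F hF h3) T (S.erase x) L _ _ hLT hLS]
    simp only [hL, lam3_C_add_X]
    rw [hwsum (fun y => ((d y)⁻¹) ^ 3 / 3) (by rw [← sum_div, hps 3 (by norm_num) le_rfl, zero_div]), phiBarPow, sum_div]
    simp only [hd, hU]
    exact sum_congr rfl fun y _ => by ring
  -- case analysis on the layer `E_x + M ∈ {0, 1, 2, 3}`
  unfold resGen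
  rw [hloc]
  have hlayer : E x + (M : ℤ) = 0 ∨ E x + (M : ℤ) = 1 ∨ E x + (M : ℤ) = 2 ∨ E x + (M : ℤ) = 3 := by omega
  rcases hlayer with h0 | h1 | h2' | h3'
  · rw [show mult E M x - 1 = 3 by simp only [mult]; omega, coeff_three_eq_lam F hc0' h2 h3, hc0, hl1, hl2, hl3, kapBar, if_pos h0]
    ring
  · rw [show mult E M x - 1 = 2 by simp only [mult]; omega, coeff_two_eq_lam F hc0' h2, hc0, hl1, hl2, kapBar, if_neg (by omega),
      if_pos h1]
    ring
  · rw [show mult E M x - 1 = 1 by simp only [mult]; omega, coeff_one_eq_lam F hc0', hc0, hl1, kapBar, if_neg (by omega),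
      if_neg (by omega), if_pos h2']
  · rw [show mult E M x - 1 = 0 by simp only [mult]; omega, hc0, kapBar, if_neg (by omega), if_neg (by omega), if_neg (by omega),
      mul_one]

end Local

/-! ## The identity -/

section Identity

variable {p : ℕ} [hp : Fact p.Prime]

/-- **The residue identity with poles of order ≤ 4.**  `Σ_{E_x + M − 4 < 0} ḡ_x(E) · κ̄_x = 0` in `ZMod p`. -/
theorem sum_gBarE_mul_kapBar_eq_zero (E : ℕ → ℤ) (M : ℕ) (hp5 : 5 ≤ p) (hM : 4 ≤ M) (hMe : Even M)
    (hE : ∀ y, y < p → -(M : ℤ) ≤ E y) (hdeg : (p : ℤ) * ((M : ℤ) - 4) + ∑ y ∈ range p, E y ≤ -2) :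
    ∑ x ∈ poleSet p E M, gBarE p E x * kapBar p E M x = 0 := by
  classical
  set S := poleSet p E M with hS
  set T := regSet p E M with hT
  -- hypotheses of the algebraic residue theorem
  have hinj : Set.InjOn (fun y : ℕ => -((y : ℕ) : ZMod p)) (S : Set ℕ) := by
    intro x hx y hy hxy
    exact natCast_injOn (mem_poleSet.1 (mem_coe.1 hx)).1 (mem_poleSet.1 (mem_coe.1 hy)).1 (neg_inj.1 hxy)
  have hm1 : ∀ x ∈ S, 1 ≤ mult E M x := by
    intro x hx
    have := (mem_poleSet.1 hx).2
    simp only [mult]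
    omega
  have hPdeg : (numPoly p E M).natDegree = ∑ y ∈ T, kreg E M y := by
    rw [numPoly, natDegree_prod_of_monic _ _ (fun y _ => (monic_X_sub_C _).pow _)]
    exact sum_congr rfl fun y _ => by rw [(monic_X_sub_C _).natDegree_pow, natDegree_X_sub_C, mul_one]
  have hAdeg : (numPoly p E M).natDegree + 2 ≤ ∑ x ∈ S, mult E M x := by
    have hsplit : ∑ y ∈ range p, (E y + (M : ℤ) - 4) = ∑ y ∈ T, (E y + (M : ℤ) - 4) + ∑ y ∈ S, (E y + (M : ℤ) - 4) := by
      rw [hT, hS, regSet, poleSet, ← sum_filter_add_sum_filter_not (range p) (fun y => 0 ≤ E y + (M : ℤ) - 4)]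
      congr 1
      exact sum_congr (filter_congr (fun y _ => not_le)) (fun _ _ => rfl)
    have hTsum : ∑ y ∈ T, (E y + (M : ℤ) - 4) = ∑ y ∈ T, (kreg E M y : ℤ) :=
      sum_congr rfl fun y hy => (Int.toNat_of_nonneg (mem_regSet.1 hy).2).symm
    have hSsum : ∑ y ∈ S, (E y + (M : ℤ) - 4) = -∑ y ∈ S, (mult E M y : ℤ) := by
      rw [← sum_neg_distrib]
      exact sum_congr rfl fun y hy => by
        simp only [mult]
        rw [Int.toNat_of_nonneg (by have := (mem_poleSet.1 hy).2; omega)]; ring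
    have htot : ∑ y ∈ range p, (E y + (M : ℤ) - 4) = ∑ y ∈ range p, E y + (p : ℤ) * ((M : ℤ) - 4) := by
      simp only [sum_sub_distrib, sum_add_distrib, sum_const, card_range, nsmul_eq_mul]
      ring
    have hkey : (∑ y ∈ T, (kreg E M y : ℤ)) + 2 ≤ ∑ y ∈ S, (mult E M y : ℤ) := by
      linarith [hsplit, hSsum, htot, hTsum, hdeg]
    have hnat : ∑ y ∈ T, kreg E M y + 2 ≤ ∑ y ∈ S, mult E M y := by exact_mod_cast hkey
    rwa [hPdeg]
  rw [← sum_resGen_eq_zero S (fun y : ℕ => -((y : ℕ) : ZMod p)) (mult E M) hinj hm1 (numPoly p E M) hAdeg]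
  exact sum_congr rfl fun x hx => (resGen_numPoly_eq E M hp5 hM hMe hE hx).symm

end Identity

end Summit.KontsevichZagierPeriods.Zeta5Search.ResidueFour
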